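import Literature.Barriers.CriticalPhenomena.PlaquetteWalkHoleRootTightNearCells
import Literature.Barriers.CriticalPhenomena.PlaquetteWalkHoleRootNearCells
import Literature.Barriers.CriticalPhenomena.PlaquetteWalkHoleRootRootNotchEast
import HarnessLib

/-!
# Barrier catalogue (SAWScalingLimit): LAW L FOR EVERY SET OF NEAR CELLS — four witnesses avoiding all of `holeS, rootS, holeN, rootN`

Leaf of `PlaquetteWalkHoleRootTightNearCells` / `PlaquetteWalkHoleRootRootNotchEast` (the emptiness theorems for ANY defect
list: dead door below / above, root notch at the east ray; the generic one-route sign theorems) and `PlaquetteWalkHoleRootNearCells`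
(the every-position witness pattern). Setting: the `m × n` box, hole `h`, root plaquette `(h.1 + 1, h.2)` rooted at `W`, far cell
`(h.1 − 1, h.2)`, and an ARBITRARY defect list `S ∋ h` contained in the five-cell set `{h, holeS, rootS, holeN, rootN}` (the hole
and any of its four near cells: vertical dominoes and triominoes through the hole, single and double root notches, the «C» around
the root plaquette, …).

§1 Four kit witnesses AVOIDING ALL FOUR near cells at once (kit j298316 of the lane, tasks `{(3,1),(3,3),(4,1),(4,3)} US2/US1/ON2/ON1`
in `[0,6]×[−1,5]`, 28 arcs each): `nearSetBlockSU2/SU1` (under, `[1,6]×[−1,4]`), `nearSetBlockNO2/NO1` (over, `[1,6]×[0,5]`), with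
`decide` certificates and every-position theorems — ONE witness set for all fifteen sub-configurations.
§2 `block_hroot_subset_boxMinus_nearSet` (placement under any such `S`) and ★★★★★ `lawL_box_nearSet_not_killed`: `2 ≤ h.1`,
`h.1 + 4 ≤ m`, `3 ≤ h.2`, `h.2 + 4 ≤ n` ⇒ for EVERY such `S`, NONE of the four kill statements of LAW L holds at the far cell.
§3 the tight bottom / top for every such `S` containing a cell of that side: `lawL_box_nearSet_tightS_im_vertexFunctional_pos`
(`h.2 = 2`, `holeS ∈ S ∨ rootS ∈ S`, `h.1 + 4 ≤ m`, `h.2 + 4 ≤ n` ⇒ `Im VF > 0` on `[π/3, 2π/3]`), `…tightN…neg`; and ★★★★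
`lawL_box_doubleNotch_east_vertexFunctional_eq_zero` — `rootE` in the last column (`h.1 + 3 = m`) with BOTH root notches in `S`
⇒ both routes EMPTY ⇒ `VF ≡ 0`, whatever else of the five cells `S` removes and whatever the height.

Not in print; venture lane «pcv-sawmu», seat b-step0 gen 28 (kit j298316 «nearpairs», HOME `code/step0/g28/kit/`).

References: A. Glazman, I. Manolescu, arXiv:1708.00395v3, §1 (Fig. 1, Fig. 2, remark after eq. (1)), §2.1, §4.2, Lemma 2.1
[GlazmanManolescu2019]; A. Glazman, Electron. Commun. Probab. 20 (2015) no. 86, Lemma 3.1, proof pp. 6–7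
[Glazman2015WeightedSAW]; R. Courant, H. Robbins, *What is Mathematics?* (1941/1958), Ch. V Appendix §2 (the even–odd
rule) [CourantRobbins1958].
-/

noncomputable section

open Set Function Complex

namespace Literature.Barriers.CriticalPhenomena.PlaquetteWalk

open Literature.Probability.RandomPlanarGeometry.SAW.YangBaxter
open Real Complex

/-! ## §1 The four near-set witnesses (reference root `w42 = (4, 2)`, hole `(3, 2)`, far cell `(2, 2)`) -/

section Witnesses

/-- Near-set witness block `SU2`: the 28 cells of an under w₂-free wound witness (reference root `(4, 2)`, hole
`(3, 2)`, far cell `(2, 2)`) AVOIDING ALL FOUR near cells `(3,1), (4,1), (3,3), (4,3)`; cells in `[1,6]×[-1,4]` (kit j298316 of the lane).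
[cite: GlazmanManolescu2019, §2.1 (finite domains of faces)] -/
def nearSetBlockSU242 : List Face := [(1,-1),(1,0),(1,1),(1,2),(2,-1),(2,0),(2,1),(2,2),(2,3),(2,4),(3,-1),(3,0),(3,4),(4,-1),(4,0),(4,2),(4,4),(5,-1),(5,0),(5,1),(5,2),(5,3),(5,4),(6,-1),(6,0),(6,1),(6,2),(6,3)]

/-- Its mid-edges (28 arcs). [cite: GlazmanManolescu2019, §1 (definition of the model), Fig. 1] -/
def nearSetSU2Mids : List MidEdge :=
  [.vert 4 2, .vert 5 2, .slant 5 2, .slant 5 1, .vert 5 0, .vert 4 0, .vert 3 0, .slant 2 1, .slant 2 2, .vert 2 2, .slant 1 2, .slant 1 1, .slant 1 0, .vert 2 (-1), .vert 3 (-1), .vert 4 (-1), .vert 5 (-1), .vert 6 (-1), .slant 6 0, .slant 6 1, .slant 6 2, .slant 6 3, .vert 6 3, .slant 5 4, .vert 5 4, .vert 4 4, .vert 3 4, .slant 2 4, .slant 2 3]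

/-- The witness as a walk of its block. [cite: GlazmanManolescu2019, §1 (definition of the model), Fig. 1] -/
def nearSetSU2Walk : YBWalk (dom nearSetBlockSU242) (w42.side .W) ((farW w42).side .N) where
  mids := nearSetSU2Mids
  head_eq := by decide
  getLast_eq := by decide
  nodup := by decide
  arc_mem := arc_mem_of_check (by decide)
  isChain := by decide
  noncross := noncross_of_check (by decide)

/-- The labelled witness. [cite: Glazman2015WeightedSAW, Lemma 3.1 (proof, pp. 6–7)] -/
def ωnearSetSU2 : ΩG (dom nearSetBlockSU242) (w42.side .W) (farW w42) := ⟨.N, nearSetSU2Walk⟩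

/-- Certificates: first hit `8`, `28` arcs, no later far-cell arc, first side `S`, w₂-free off the far cell, odd
eastern-ray count. [cite: Glazman2015WeightedSAW, Lemma 3.1 (proof, pp. 6–7)] [cite: CourantRobbins1958, Ch. V Appendix §2 (the even–odd rule)] -/
theorem ωnearSetSU2_cert : ωnearSetSU2.2.firstHitG = 8 ∧ ωnearSetSU2.2.arcs.length = 28 ∧
    (∀ j < 28, 8 < j → ωnearSetSU2.2.fc j ≠ farW w42) ∧ ωnearSetSU2.2.nth 8 = (farW w42).side .S ∧
    ωnearSetSU2.2.W2FreeOff (farW w42) ∧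
    Odd ((Finset.range 20).filter fun j => eastRayB w42 (ωnearSetSU2.2.nth (8 + j + 1)) = true).card := by
  refine ⟨by decide, by decide, by decide, by decide, by unfold YBWalk.W2FreeOff; decide, by decide⟩

/-- The block at the root plaquette `w`. [cite: GlazmanManolescu2019, §2.1, §4.2 (translation invariance)] -/
def nearSetBlockSU2 (w : Face) : List Face := nearSetBlockSU242.map (Face.shiftBy (refShift w))

/-- ★★★ The under w₂-free wound witness `SU2` at EVERY POSITION: any face list containing the translated block
carries a wound class-`B2a` under-walk at the far cell, w₂-free off it. [cite: GlazmanManolescu2019, §4.2 (translation invariance), Lemma 2.1]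
[cite: Glazman2015WeightedSAW, Lemma 3.1 (proof, pp. 6–7)] [cite: CourantRobbins1958, Ch. V Appendix §2 (the even–odd rule)] -/
theorem exists_under_W2FreeOff_of_nearSetBlockSU2 {Dl : List Face} {w : Face} (hB : ∀ c ∈ nearSetBlockSU2 w, c ∈ Dl)
    (hr : RootedFace (dom Dl) (w.side .W) (farW w)) (θ : ℝ) :
    ∃ (ω : ΩG (dom Dl) (w.side .W) (farW w)) (h : ω.IsB2a), ω.2.firstSideG = .S ∧
      ω.WE (fun _ => θ) ≠ excursionWinding θ ω.2.firstSideG (ω.z1 hr h) ω.1 ∧ ω.2.W2FreeOff (farW w) := by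
  have hB₀ := block42_mem_of_block_mem (B := nearSetBlockSU242) hB
  obtain ⟨hF, hn, hfc, hnth, hfree, hodd⟩ := ωnearSetSU2_cert
  let ω₀ : ΩG (dom (Dl.map (Face.shiftBy (-refShift w)))) (w42.side .W) (farW w42) :=
    ⟨.N, nearSetSU2Walk.mapDomain fun c hc => hB₀ c hc⟩
  have hF' : ω₀.2.firstHitG = 8 := hF
  have hn' : ω₀.2.arcs.length = 28 := hn
  have h₀ : ω₀.IsB2a := by
    refine ΩG.isB2a_of_forall_fc_ne (by rw [hF', hn']; omega) fun j hj1 hj2 => ?_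
    rw [hF'] at hj1
    rw [hn'] at hj2
    exact hfc j hj2 hj1
  have hM : ω₀.Mv = 20 := by unfold ΩG.Mv; rw [hF', hn']
  exact exists_wound_witness_shift (shiftBy_refShift_root w) (shiftBy_refShift_farW w) hr
    (fun γ r => γ.W2FreeOff r) (fun hm _ hf => YBWalk.W2FreeOff_of_mids_shift hm hf) ω₀ h₀
    (by rw [hF']; exact hnth) hfree (by rw [hM, hF']; exact hodd) θ

/-- Near-set witness block `SU1`: the 26 cells of an under w₁-free wound witness (reference root `(4, 2)`, hole
`(3, 2)`, far cell `(2, 2)`) AVOIDING ALL FOUR near cells `(3,1), (4,1), (3,3), (4,3)`; cells in `[1,6]×[-1,4]` (kit j298316 of the lane).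
[cite: GlazmanManolescu2019, §2.1 (finite domains of faces)] -/
def nearSetBlockSU142 : List Face := [(1,0),(1,1),(1,2),(2,-1),(2,0),(2,1),(2,2),(2,3),(2,4),(3,-1),(3,0),(3,4),(4,-1),(4,0),(4,2),(4,4),(5,-1),(5,0),(5,1),(5,2),(5,3),(5,4),(6,-1),(6,0),(6,1),(6,2)]

/-- Its mid-edges (28 arcs). [cite: GlazmanManolescu2019, §1 (definition of the model), Fig. 1] -/
def nearSetSU1Mids : List MidEdge :=
  [.vert 4 2, .vert 5 2, .slant 5 2, .slant 5 1, .vert 5 0, .vert 4 0, .vert 3 0, .slant 2 1, .slant 2 2, .vert 2 2, .slant 1 2, .slant 1 1, .vert 2 0, .slant 2 0, .vert 3 (-1), .vert 4 (-1), .vert 5 (-1), .vert 6 (-1), .slant 6 0, .slant 6 1, .slant 6 2, .vert 6 2, .slant 5 3, .slant 5 4, .vert 5 4, .vert 4 4, .vert 3 4, .slant 2 4, .slant 2 3]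

/-- The witness as a walk of its block. [cite: GlazmanManolescu2019, §1 (definition of the model), Fig. 1] -/
def nearSetSU1Walk : YBWalk (dom nearSetBlockSU142) (w42.side .W) ((farW w42).side .N) where
  mids := nearSetSU1Mids
  head_eq := by decide
  getLast_eq := by decide
  nodup := by decide
  arc_mem := arc_mem_of_check (by decide)
  isChain := by decide
  noncross := noncross_of_check (by decide)

/-- The labelled witness. [cite: Glazman2015WeightedSAW, Lemma 3.1 (proof, pp. 6–7)] -/
def ωnearSetSU1 : ΩG (dom nearSetBlockSU142) (w42.side .W) (farW w42) := ⟨.N, nearSetSU1Walk⟩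

/-- Certificates: first hit `8`, `28` arcs, no later far-cell arc, first side `S`, w₁-free off the far cell, odd
eastern-ray count. [cite: Glazman2015WeightedSAW, Lemma 3.1 (proof, pp. 6–7)] [cite: CourantRobbins1958, Ch. V Appendix §2 (the even–odd rule)] -/
theorem ωnearSetSU1_cert : ωnearSetSU1.2.firstHitG = 8 ∧ ωnearSetSU1.2.arcs.length = 28 ∧
    (∀ j < 28, 8 < j → ωnearSetSU1.2.fc j ≠ farW w42) ∧ ωnearSetSU1.2.nth 8 = (farW w42).side .S ∧
    ωnearSetSU1.2.W1FreeOff (farW w42) ∧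
    Odd ((Finset.range 20).filter fun j => eastRayB w42 (ωnearSetSU1.2.nth (8 + j + 1)) = true).card := by
  refine ⟨by decide, by decide, by decide, by decide, by unfold YBWalk.W1FreeOff; decide, by decide⟩

/-- The block at the root plaquette `w`. [cite: GlazmanManolescu2019, §2.1, §4.2 (translation invariance)] -/
def nearSetBlockSU1 (w : Face) : List Face := nearSetBlockSU142.map (Face.shiftBy (refShift w))

/-- ★★★ The under w₁-free wound witness `SU1` at EVERY POSITION: any face list containing the translated block
carries a wound class-`B2a` under-walk at the far cell, w₁-free off it. [cite: GlazmanManolescu2019, §4.2 (translation invariance), Lemma 2.1]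
[cite: Glazman2015WeightedSAW, Lemma 3.1 (proof, pp. 6–7)] [cite: CourantRobbins1958, Ch. V Appendix §2 (the even–odd rule)] -/
theorem exists_under_W1FreeOff_of_nearSetBlockSU1 {Dl : List Face} {w : Face} (hB : ∀ c ∈ nearSetBlockSU1 w, c ∈ Dl)
    (hr : RootedFace (dom Dl) (w.side .W) (farW w)) (θ : ℝ) :
    ∃ (ω : ΩG (dom Dl) (w.side .W) (farW w)) (h : ω.IsB2a), ω.2.firstSideG = .S ∧
      ω.WE (fun _ => θ) ≠ excursionWinding θ ω.2.firstSideG (ω.z1 hr h) ω.1 ∧ ω.2.W1FreeOff (farW w) := by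
  have hB₀ := block42_mem_of_block_mem (B := nearSetBlockSU142) hB
  obtain ⟨hF, hn, hfc, hnth, hfree, hodd⟩ := ωnearSetSU1_cert
  let ω₀ : ΩG (dom (Dl.map (Face.shiftBy (-refShift w)))) (w42.side .W) (farW w42) :=
    ⟨.N, nearSetSU1Walk.mapDomain fun c hc => hB₀ c hc⟩
  have hF' : ω₀.2.firstHitG = 8 := hF
  have hn' : ω₀.2.arcs.length = 28 := hn
  have h₀ : ω₀.IsB2a := by
    refine ΩG.isB2a_of_forall_fc_ne (by rw [hF', hn']; omega) fun j hj1 hj2 => ?_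
    rw [hF'] at hj1
    rw [hn'] at hj2
    exact hfc j hj2 hj1
  have hM : ω₀.Mv = 20 := by unfold ΩG.Mv; rw [hF', hn']
  exact exists_wound_witness_shift (shiftBy_refShift_root w) (shiftBy_refShift_farW w) hr
    (fun γ r => γ.W1FreeOff r) (fun hm _ hf => YBWalk.W1FreeOff_of_mids_shift hm hf) ω₀ h₀
    (by rw [hF']; exact hnth) hfree (by rw [hM, hF']; exact hodd) θ

/-- Near-set witness block `NO2`: the 26 cells of an over w₂-free wound witness (reference root `(4, 2)`, hole
`(3, 2)`, far cell `(2, 2)`) AVOIDING ALL FOUR near cells `(3,1), (4,1), (3,3), (4,3)`; cells in `[1,6]×[0,5]` (kit j298316 of the lane).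
[cite: GlazmanManolescu2019, §2.1 (finite domains of faces)] -/
def nearSetBlockNO242 : List Face := [(1,2),(1,3),(1,4),(2,0),(2,1),(2,2),(2,3),(2,4),(2,5),(3,0),(3,4),(3,5),(4,0),(4,2),(4,4),(4,5),(5,0),(5,1),(5,2),(5,3),(5,4),(5,5),(6,2),(6,3),(6,4),(6,5)]

/-- Its mid-edges (28 arcs). [cite: GlazmanManolescu2019, §1 (definition of the model), Fig. 1] -/
def nearSetNO2Mids : List MidEdge :=
  [.vert 4 2, .vert 5 2, .slant 5 3, .slant 5 4, .vert 5 4, .vert 4 4, .vert 3 4, .slant 2 4, .slant 2 3, .vert 2 2, .slant 1 3, .slant 1 4, .vert 2 4, .slant 2 5, .vert 3 5, .vert 4 5, .vert 5 5, .vert 6 5, .slant 6 5, .slant 6 4, .slant 6 3, .vert 6 2, .slant 5 2, .slant 5 1, .vert 5 0, .vert 4 0, .vert 3 0, .slant 2 1, .slant 2 2]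

/-- The witness as a walk of its block. [cite: GlazmanManolescu2019, §1 (definition of the model), Fig. 1] -/
def nearSetNO2Walk : YBWalk (dom nearSetBlockNO242) (w42.side .W) ((farW w42).side .S) where
  mids := nearSetNO2Mids
  head_eq := by decide
  getLast_eq := by decide
  nodup := by decide
  arc_mem := arc_mem_of_check (by decide)
  isChain := by decide
  noncross := noncross_of_check (by decide)

/-- The labelled witness. [cite: Glazman2015WeightedSAW, Lemma 3.1 (proof, pp. 6–7)] -/
def ωnearSetNO2 : ΩG (dom nearSetBlockNO242) (w42.side .W) (farW w42) := ⟨.S, nearSetNO2Walk⟩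

/-- Certificates: first hit `8`, `28` arcs, no later far-cell arc, first side `N`, w₂-free off the far cell, odd
eastern-ray count. [cite: Glazman2015WeightedSAW, Lemma 3.1 (proof, pp. 6–7)] [cite: CourantRobbins1958, Ch. V Appendix §2 (the even–odd rule)] -/
theorem ωnearSetNO2_cert : ωnearSetNO2.2.firstHitG = 8 ∧ ωnearSetNO2.2.arcs.length = 28 ∧
    (∀ j < 28, 8 < j → ωnearSetNO2.2.fc j ≠ farW w42) ∧ ωnearSetNO2.2.nth 8 = (farW w42).side .N ∧
    ωnearSetNO2.2.W2FreeOff (farW w42) ∧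
    Odd ((Finset.range 20).filter fun j => eastRayB w42 (ωnearSetNO2.2.nth (8 + j + 1)) = true).card := by
  refine ⟨by decide, by decide, by decide, by decide, by unfold YBWalk.W2FreeOff; decide, by decide⟩

/-- The block at the root plaquette `w`. [cite: GlazmanManolescu2019, §2.1, §4.2 (translation invariance)] -/
def nearSetBlockNO2 (w : Face) : List Face := nearSetBlockNO242.map (Face.shiftBy (refShift w))

/-- ★★★ The over w₂-free wound witness `NO2` at EVERY POSITION: any face list containing the translated block
carries a wound class-`B2a` over-walk at the far cell, w₂-free off it. [cite: GlazmanManolescu2019, §4.2 (translation invariance), Lemma 2.1]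
[cite: Glazman2015WeightedSAW, Lemma 3.1 (proof, pp. 6–7)] [cite: CourantRobbins1958, Ch. V Appendix §2 (the even–odd rule)] -/
theorem exists_over_W2FreeOff_of_nearSetBlockNO2 {Dl : List Face} {w : Face} (hB : ∀ c ∈ nearSetBlockNO2 w, c ∈ Dl)
    (hr : RootedFace (dom Dl) (w.side .W) (farW w)) (θ : ℝ) :
    ∃ (ω : ΩG (dom Dl) (w.side .W) (farW w)) (h : ω.IsB2a), ω.2.firstSideG = .N ∧
      ω.WE (fun _ => θ) ≠ excursionWinding θ ω.2.firstSideG (ω.z1 hr h) ω.1 ∧ ω.2.W2FreeOff (farW w) := by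
  have hB₀ := block42_mem_of_block_mem (B := nearSetBlockNO242) hB
  obtain ⟨hF, hn, hfc, hnth, hfree, hodd⟩ := ωnearSetNO2_cert
  let ω₀ : ΩG (dom (Dl.map (Face.shiftBy (-refShift w)))) (w42.side .W) (farW w42) :=
    ⟨.S, nearSetNO2Walk.mapDomain fun c hc => hB₀ c hc⟩
  have hF' : ω₀.2.firstHitG = 8 := hF
  have hn' : ω₀.2.arcs.length = 28 := hn
  have h₀ : ω₀.IsB2a := by
    refine ΩG.isB2a_of_forall_fc_ne (by rw [hF', hn']; omega) fun j hj1 hj2 => ?_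
    rw [hF'] at hj1
    rw [hn'] at hj2
    exact hfc j hj2 hj1
  have hM : ω₀.Mv = 20 := by unfold ΩG.Mv; rw [hF', hn']
  exact exists_wound_witness_shift (shiftBy_refShift_root w) (shiftBy_refShift_farW w) hr
    (fun γ r => γ.W2FreeOff r) (fun hm _ hf => YBWalk.W2FreeOff_of_mids_shift hm hf) ω₀ h₀
    (by rw [hF']; exact hnth) hfree (by rw [hM, hF']; exact hodd) θ

/-- Near-set witness block `NO1`: the 28 cells of an over w₁-free wound witness (reference root `(4, 2)`, hole
`(3, 2)`, far cell `(2, 2)`) AVOIDING ALL FOUR near cells `(3,1), (4,1), (3,3), (4,3)`; cells in `[1,6]×[0,5]` (kit j298316 of the lane).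
[cite: GlazmanManolescu2019, §2.1 (finite domains of faces)] -/
def nearSetBlockNO142 : List Face := [(1,2),(1,3),(1,4),(1,5),(2,0),(2,1),(2,2),(2,3),(2,4),(2,5),(3,0),(3,4),(3,5),(4,0),(4,2),(4,4),(4,5),(5,0),(5,1),(5,2),(5,3),(5,4),(5,5),(6,1),(6,2),(6,3),(6,4),(6,5)]

/-- Its mid-edges (28 arcs). [cite: GlazmanManolescu2019, §1 (definition of the model), Fig. 1] -/
def nearSetNO1Mids : List MidEdge :=
  [.vert 4 2, .vert 5 2, .slant 5 3, .slant 5 4, .vert 5 4, .vert 4 4, .vert 3 4, .slant 2 4, .slant 2 3, .vert 2 2, .slant 1 3, .slant 1 4, .slant 1 5, .vert 2 5, .vert 3 5, .vert 4 5, .vert 5 5, .vert 6 5, .slant 6 5, .slant 6 4, .slant 6 3, .slant 6 2, .vert 6 1, .slant 5 1, .vert 5 0, .vert 4 0, .vert 3 0, .slant 2 1, .slant 2 2]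

/-- The witness as a walk of its block. [cite: GlazmanManolescu2019, §1 (definition of the model), Fig. 1] -/
def nearSetNO1Walk : YBWalk (dom nearSetBlockNO142) (w42.side .W) ((farW w42).side .S) where
  mids := nearSetNO1Mids
  head_eq := by decide
  getLast_eq := by decide
  nodup := by decide
  arc_mem := arc_mem_of_check (by decide)
  isChain := by decide
  noncross := noncross_of_check (by decide)

/-- The labelled witness. [cite: Glazman2015WeightedSAW, Lemma 3.1 (proof, pp. 6–7)] -/
def ωnearSetNO1 : ΩG (dom nearSetBlockNO142) (w42.side .W) (farW w42) := ⟨.S, nearSetNO1Walk⟩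

/-- Certificates: first hit `8`, `28` arcs, no later far-cell arc, first side `N`, w₁-free off the far cell, odd
eastern-ray count. [cite: Glazman2015WeightedSAW, Lemma 3.1 (proof, pp. 6–7)] [cite: CourantRobbins1958, Ch. V Appendix §2 (the even–odd rule)] -/
theorem ωnearSetNO1_cert : ωnearSetNO1.2.firstHitG = 8 ∧ ωnearSetNO1.2.arcs.length = 28 ∧
    (∀ j < 28, 8 < j → ωnearSetNO1.2.fc j ≠ farW w42) ∧ ωnearSetNO1.2.nth 8 = (farW w42).side .N ∧
    ωnearSetNO1.2.W1FreeOff (farW w42) ∧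
    Odd ((Finset.range 20).filter fun j => eastRayB w42 (ωnearSetNO1.2.nth (8 + j + 1)) = true).card := by
  refine ⟨by decide, by decide, by decide, by decide, by unfold YBWalk.W1FreeOff; decide, by decide⟩

/-- The block at the root plaquette `w`. [cite: GlazmanManolescu2019, §2.1, §4.2 (translation invariance)] -/
def nearSetBlockNO1 (w : Face) : List Face := nearSetBlockNO142.map (Face.shiftBy (refShift w))

/-- ★★★ The over w₁-free wound witness `NO1` at EVERY POSITION: any face list containing the translated block
carries a wound class-`B2a` over-walk at the far cell, w₁-free off it. [cite: GlazmanManolescu2019, §4.2 (translation invariance), Lemma 2.1]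
[cite: Glazman2015WeightedSAW, Lemma 3.1 (proof, pp. 6–7)] [cite: CourantRobbins1958, Ch. V Appendix §2 (the even–odd rule)] -/
theorem exists_over_W1FreeOff_of_nearSetBlockNO1 {Dl : List Face} {w : Face} (hB : ∀ c ∈ nearSetBlockNO1 w, c ∈ Dl)
    (hr : RootedFace (dom Dl) (w.side .W) (farW w)) (θ : ℝ) :
    ∃ (ω : ΩG (dom Dl) (w.side .W) (farW w)) (h : ω.IsB2a), ω.2.firstSideG = .N ∧
      ω.WE (fun _ => θ) ≠ excursionWinding θ ω.2.firstSideG (ω.z1 hr h) ω.1 ∧ ω.2.W1FreeOff (farW w) := by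
  have hB₀ := block42_mem_of_block_mem (B := nearSetBlockNO142) hB
  obtain ⟨hF, hn, hfc, hnth, hfree, hodd⟩ := ωnearSetNO1_cert
  let ω₀ : ΩG (dom (Dl.map (Face.shiftBy (-refShift w)))) (w42.side .W) (farW w42) :=
    ⟨.S, nearSetNO1Walk.mapDomain fun c hc => hB₀ c hc⟩
  have hF' : ω₀.2.firstHitG = 8 := hF
  have hn' : ω₀.2.arcs.length = 28 := hn
  have h₀ : ω₀.IsB2a := by
    refine ΩG.isB2a_of_forall_fc_ne (by rw [hF', hn']; omega) fun j hj1 hj2 => ?_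
    rw [hF'] at hj1
    rw [hn'] at hj2
    exact hfc j hj2 hj1
  have hM : ω₀.Mv = 20 := by unfold ΩG.Mv; rw [hF', hn']
  exact exists_wound_witness_shift (shiftBy_refShift_root w) (shiftBy_refShift_farW w) hr
    (fun γ r => γ.W1FreeOff r) (fun hm _ hf => YBWalk.W1FreeOff_of_mids_shift hm hf) ω₀ h₀
    (by rw [hF']; exact hnth) hfree (by rw [hM, hF']; exact hodd) θ

end Witnesses

/-! ## §2–§3 Boxes minus the hole and any set of near cells -/

section Boxes

variable {m n : ℕ} {S : List Face} {h : Face}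

/-- **Placement under an arbitrary near-cell defect list.** A reference block within the bounds avoiding the hole and all four
reference near cells sits in `boxMinus m n S` for every `S ⊆ {h, holeS, rootS, holeN, rootN}` (given the room).
[cite: GlazmanManolescu2019, §2.1 (finite domains of faces), §4.2 (translation invariance)] -/
theorem block_hroot_subset_boxMinus_nearSet (B : List Face) (x0 x1 y0 y1 : ℤ)
    (hB : ∀ a ∈ B, x0 ≤ a.1 ∧ a.1 ≤ x1 ∧ y0 ≤ a.2 ∧ a.2 ≤ y1 ∧ a ≠ (3, 2) ∧ a ≠ (3, 1) ∧ a ≠ (4, 1) ∧ a ≠ (3, 3) ∧ a ≠ (4, 3))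
    (hW : 3 ≤ x0 + h.1) (hE : x1 + h.1 ≤ m + 2) (hS : 2 ≤ y0 + h.2) (hN : y1 + h.2 ≤ n + 1)
    (hSn : ∀ s ∈ S, s = h ∨ s = (h.1, h.2 - 1) ∨ s = (h.1 + 1, h.2 - 1) ∨ s = (h.1, h.2 + 1) ∨ s = (h.1 + 1, h.2 + 1)) :
    ∀ c ∈ B.map (Face.shiftBy (refShift (h.1 + 1, h.2))), c ∈ boxMinus m n S := by
  intro c hc'
  rw [List.mem_map] at hc'
  obtain ⟨a, ha, rfl⟩ := hc'
  obtain ⟨b1, b2, b3, b4, b5, b6, b7, b8, b9⟩ := hB a ha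
  obtain ⟨x, y⟩ := a
  simp only [ne_eq, Prod.mk.injEq, not_and] at b1 b2 b3 b4 b5 b6 b7 b8 b9
  rw [shiftBy_refShift_mk, mem_boxMinus]
  refine ⟨⟨by omega, by omega, by omega, by omega⟩, fun hs => ?_⟩
  rcases hSn _ hs with e | e | e | e | e <;>
    (have e' := Prod.ext_iff.1 e; simp only at e'; omega)

/-- The far cell is not one of the five cells. [folklore] -/
private theorem farCell_not_mem_nearSet
    (hSn : ∀ s ∈ S, s = h ∨ s = (h.1, h.2 - 1) ∨ s = (h.1 + 1, h.2 - 1) ∨ s = (h.1, h.2 + 1) ∨ s = (h.1 + 1, h.2 + 1)) :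
    ((h.1 - 1, h.2) : Face) ∉ S := by
  intro hs
  rcases hSn _ hs with e | e | e | e | e <;>
    (have e' := (Prod.ext_iff.1 e).1; simp only at e'; omega)

/-- ★★★★★ **EVERY SET OF NEAR CELLS IS HARMLESS IN THE INTERIOR.** In the `m × n` box with `2 ≤ h.1`, `h.1 + 4 ≤ m`, `3 ≤ h.2`,
`h.2 + 4 ≤ n`, remove the hole `h` and ANY sub-collection of its four near cells `holeS, rootS, holeN, rootN` (`S ∋ h` inside the
five-cell set; the rooting hypothesis carries the hole's absence). Then at every angle NONE of the four universal kill statements of LAW L holds: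
the four near-set witnesses of §1 avoid all five cells and fit `[1,6]×[−1,4]` / `[1,6]×[0,5]`.
[cite: GlazmanManolescu2019, §1 (Fig. 2 and the remark after eq. (1)), §2.1, §4.2, Lemma 2.1]
[cite: Glazman2015WeightedSAW, Lemma 3.1 (proof, pp. 6–7)] [cite: CourantRobbins1958, Ch. V Appendix §2 (the even–odd rule)] -/
theorem lawL_box_nearSet_not_killed (hW : 2 ≤ h.1) (hE : h.1 + 4 ≤ m) (hS : 3 ≤ h.2) (hN : h.2 + 4 ≤ n)
    (hSn : ∀ s ∈ S, s = h ∨ s = (h.1, h.2 - 1) ∨ s = (h.1 + 1, h.2 - 1) ∨ s = (h.1, h.2 + 1) ∨ s = (h.1 + 1, h.2 + 1))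
    (hr : RootedFace (dom (boxMinus m n S)) (Face.side (h.1 + 1, h.2) .W) (farW (h.1 + 1, h.2))) (θ : ℝ) :
    (¬ ∀ (ω : ΩG (dom (boxMinus m n S)) (Face.side (h.1 + 1, h.2) .W) (farW (h.1 + 1, h.2))) (hb : ω.IsB2a),
        ω.2.firstSideG = .S → ω.WE (fun _ => θ) ≠ excursionWinding θ ω.2.firstSideG (ω.z1 hr hb) ω.1 →
          ¬ω.2.W2FreeOff (farW (h.1 + 1, h.2))) ∧
      (¬ ∀ (ω : ΩG (dom (boxMinus m n S)) (Face.side (h.1 + 1, h.2) .W) (farW (h.1 + 1, h.2))) (hb : ω.IsB2a),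
        ω.2.firstSideG = .N → ω.WE (fun _ => θ) ≠ excursionWinding θ ω.2.firstSideG (ω.z1 hr hb) ω.1 →
          ¬ω.2.W1FreeOff (farW (h.1 + 1, h.2))) ∧
      (¬ ∀ (ω : ΩG (dom (boxMinus m n S)) (Face.side (h.1 + 1, h.2) .W) (farW (h.1 + 1, h.2))) (hb : ω.IsB2a),
        ω.2.firstSideG = .S → ω.WE (fun _ => θ) ≠ excursionWinding θ ω.2.firstSideG (ω.z1 hr hb) ω.1 →
          ¬ω.2.W1FreeOff (farW (h.1 + 1, h.2))) ∧
      (¬ ∀ (ω : ΩG (dom (boxMinus m n S)) (Face.side (h.1 + 1, h.2) .W) (farW (h.1 + 1, h.2))) (hb : ω.IsB2a),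
        ω.2.firstSideG = .N → ω.WE (fun _ => θ) ≠ excursionWinding θ ω.2.firstSideG (ω.z1 hr hb) ω.1 →
          ¬ω.2.W2FreeOff (farW (h.1 + 1, h.2))) := by
  have sub := block_hroot_subset_boxMinus_nearSet (m := m) (n := n) (S := S) (h := h)
  exact not_killed_of_witnesses hr θ
    (exists_under_W2FreeOff_of_nearSetBlockSU2 (sub nearSetBlockSU242 1 6 (-1) 4 (by decide) (by omega) (by omega) (by omega)
      (by omega) hSn) hr θ)
    (exists_over_W1FreeOff_of_nearSetBlockNO1 (sub nearSetBlockNO142 1 6 0 5 (by decide) (by omega) (by omega) (by omega)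
      (by omega) hSn) hr θ)
    (exists_under_W1FreeOff_of_nearSetBlockSU1 (sub nearSetBlockSU142 1 6 (-1) 4 (by decide) (by omega) (by omega) (by omega)
      (by omega) hSn) hr θ)
    (exists_over_W2FreeOff_of_nearSetBlockNO2 (sub nearSetBlockNO242 1 6 0 5 (by decide) (by omega) (by omega) (by omega)
      (by omega) hSn) hr θ)

/-- ★★★★★ **TIGHT BOTTOM, ANY NEAR SET WITH A CELL BELOW: `Im VF > 0` ON THE WHOLE RANGE.** `h.2 = 2`, `holeS ∈ S` or `rootS ∈ S`
(`S ∋ h` inside the five-cell set), `2 ≤ h.1`, `h.1 + 4 ≤ m`, `h.2 + 4 ≤ n`: the under route is EMPTY by the dead door below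
(`lawL_box_tightS_not_wound_under`), the over near-set witnesses fit `[1,6]×[0,5]`.
[cite: GlazmanManolescu2019, Lemma 2.1 (statement, "in the form given in [Gl]"), §1 eq. (1), §2.1]
[cite: Glazman2015WeightedSAW, Lemma 3.1 (proof, pp. 6–7)] [cite: CourantRobbins1958, Ch. V Appendix §2 (the even–odd rule)] -/
theorem lawL_box_nearSet_tightS_im_vertexFunctional_pos (hW : 2 ≤ h.1) (hE : h.1 + 4 ≤ m) (hS2 : h.2 = 2) (hN : h.2 + 4 ≤ n)
    (hh : h ∈ S) (hc : ((h.1, 1) : Face) ∈ S ∨ ((h.1 + 1, 1) : Face) ∈ S)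
    (hSn : ∀ s ∈ S, s = h ∨ s = (h.1, h.2 - 1) ∨ s = (h.1 + 1, h.2 - 1) ∨ s = (h.1, h.2 + 1) ∨ s = (h.1 + 1, h.2 + 1))
    {θ : ℝ} (hθ : θ ∈ Set.Icc (π / 3) (2 * π / 3)) :
    0 < (vertexFunctional (printedWeights θ) tFiveEighths (ybCoeff θ) (boxMinus m n S) (Face.side (h.1 + 1, h.2) .W)
      (farW (h.1 + 1, h.2))).im := by
  have sub := block_hroot_subset_boxMinus_nearSet (m := m) (n := n) (S := S) (h := h)
  have hfS := farCell_not_mem_nearSet hSn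
  have hf := farW_hroot_mem_boxMinus_of_not_mem (m := m) (n := n) (by omega) (by omega) (by omega) (by omega) hfS
  have hr := rootedFace_hroot_boxMinus_of_mem hf hh
  have hhD : holeFaceW ((h.1 + 1, h.2) : Face) ∉ dom (boxMinus m n S) := by
    rw [holeFaceW_hroot]; exact not_mem_dom_boxMinus_of_mem hh
  refine im_vertexFunctional_printed_pos_of_under_unwound hθ hf hhD hr
    (fun θ' ω hb hs => lawL_box_tightS_not_wound_under (by omega) (by omega) hS2 (by omega) hh hfS hc ω hb hs θ')
    (exists_over_W2FreeOff_of_nearSetBlockNO2 (sub nearSetBlockNO242 1 6 0 5 (by decide) (by omega) (by omega) (by omega)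
      (by omega) hSn) hr)
    (exists_over_W1FreeOff_of_nearSetBlockNO1 (sub nearSetBlockNO142 1 6 0 5 (by decide) (by omega) (by omega) (by omega)
      (by omega) hSn) hr)

/-- ★★★★★ **TIGHT TOP, ANY NEAR SET WITH A CELL ABOVE: `Im VF < 0` ON THE WHOLE RANGE** (`h.2 + 3 = n`, `holeN ∈ S` or `rootN ∈ S`,
`2 ≤ h.1`, `h.1 + 4 ≤ m`, `3 ≤ h.2`). [cite: GlazmanManolescu2019, Lemma 2.1 (statement, "in the form given in [Gl]"), §1 eq. (1), §2.1]
[cite: Glazman2015WeightedSAW, Lemma 3.1 (proof, pp. 6–7)] [cite: CourantRobbins1958, Ch. V Appendix §2 (the even–odd rule)] -/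
theorem lawL_box_nearSet_tightN_im_vertexFunctional_neg (hW : 2 ≤ h.1) (hE : h.1 + 4 ≤ m) (hS : 3 ≤ h.2) (hN3 : h.2 + 3 = n)
    (hh : h ∈ S) (hc : ((h.1, h.2 + 1) : Face) ∈ S ∨ ((h.1 + 1, h.2 + 1) : Face) ∈ S)
    (hSn : ∀ s ∈ S, s = h ∨ s = (h.1, h.2 - 1) ∨ s = (h.1 + 1, h.2 - 1) ∨ s = (h.1, h.2 + 1) ∨ s = (h.1 + 1, h.2 + 1))
    {θ : ℝ} (hθ : θ ∈ Set.Icc (π / 3) (2 * π / 3)) :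
    (vertexFunctional (printedWeights θ) tFiveEighths (ybCoeff θ) (boxMinus m n S) (Face.side (h.1 + 1, h.2) .W)
      (farW (h.1 + 1, h.2))).im < 0 := by
  have sub := block_hroot_subset_boxMinus_nearSet (m := m) (n := n) (S := S) (h := h)
  have hfS := farCell_not_mem_nearSet hSn
  have hf := farW_hroot_mem_boxMinus_of_not_mem (m := m) (n := n) (by omega) (by omega) (by omega) (by omega) hfS
  have hr := rootedFace_hroot_boxMinus_of_mem hf hh
  have hhD : holeFaceW ((h.1 + 1, h.2) : Face) ∉ dom (boxMinus m n S) := by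
    rw [holeFaceW_hroot]; exact not_mem_dom_boxMinus_of_mem hh
  refine im_vertexFunctional_printed_neg_of_over_unwound hθ hf hhD hr
    (fun θ' ω hb hs => lawL_box_tightN_not_wound_over (by omega) (by omega) (by omega) hN3 hh hfS hc ω hb hs θ')
    (exists_under_W2FreeOff_of_nearSetBlockSU2 (sub nearSetBlockSU242 1 6 (-1) 4 (by decide) (by omega) (by omega) (by omega)
      (by omega) hSn) hr)
    (exists_under_W1FreeOff_of_nearSetBlockSU1 (sub nearSetBlockSU142 1 6 (-1) 4 (by decide) (by omega) (by omega) (by omega)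
      (by omega) hSn) hr)

/-- ★★★★ **THE DOUBLY NOTCHED ROOT PLAQUETTE WITH `rootE` IN THE LAST COLUMN: `VF ≡ 0`.** `h.1 + 3 = m` and BOTH `rootS`, `rootN` in
`S` (`S ∋ h`, far cell kept, hole anywhere in height: `0 ≤ h.2`, `h.2 + 1 ≤ n`): the root notch at the east ray empties the under
route AND the over route (`lawL_box_eastRootE_rootS_not_wound_under`, `…rootN_not_wound_over`), so the vertex functional vanishes on
`[π/3, 2π/3]`. [cite: GlazmanManolescu2019, Lemma 2.1 (statement, "in the form given in [Gl]"), §2.1]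
[cite: Glazman2015WeightedSAW, Lemma 3.1 (proof, pp. 6–7)] [cite: CourantRobbins1958, Ch. V Appendix §2 (the even–odd rule)] -/
theorem lawL_box_doubleNotch_east_vertexFunctional_eq_zero (hW : 1 ≤ h.1) (hE3 : h.1 + 3 = m) (hS0 : 0 ≤ h.2) (hN : h.2 + 1 ≤ n)
    (hh : h ∈ S) (hfS : ((h.1 - 1, h.2) : Face) ∉ S) (hcS : ((h.1 + 1, h.2 - 1) : Face) ∈ S) (hcN : ((h.1 + 1, h.2 + 1) : Face) ∈ S)
    {θ : ℝ} (hθ : θ ∈ Set.Icc (π / 3) (2 * π / 3)) :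
    vertexFunctional (printedWeights θ) tFiveEighths (ybCoeff θ) (boxMinus m n S) (Face.side (h.1 + 1, h.2) .W)
      (farW (h.1 + 1, h.2)) = 0 := by
  have hf := farW_hroot_mem_boxMinus_of_not_mem (m := m) (n := n) hW (by omega) hS0 hN hfS
  have hr := rootedFace_hroot_boxMinus_of_mem hf hh
  have hhD : holeFaceW ((h.1 + 1, h.2) : Face) ∉ dom (boxMinus m n S) := by
    rw [holeFaceW_hroot]; exact not_mem_dom_boxMinus_of_mem hh
  rw [vertexFunctional_printed_farCellW_eq hθ _ _ hf hhD hr,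
    ΩG.sum_routeMassW_eq_zero_of_unwound hr .S θ (fun ω hb hs =>
      lawL_box_eastRootE_rootS_not_wound_under hW hE3 hS0 hN hh hfS hcS ω hb hs θ),
    ΩG.sum_routeMassW_eq_zero_of_unwound hr .N θ (fun ω hb hs =>
      lawL_box_eastRootE_rootN_not_wound_over hW hE3 hS0 hN hh hfS hcN ω hb hs θ)]
  simp

end Boxes

end Literature.Barriers.CriticalPhenomena.PlaquetteWalk
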